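import Literature.Probability.RandomPlanarGeometry.ConformalRemovability
import Literature.Probability.RandomPlanarGeometry.ConformalRemovabilityTwoPointEstimate
import Literature.Probability.RandomPlanarGeometry.ConformalRemovabilityTwoPoint
import Mathlib.Analysis.Calculus.Deriv.CompMul
import HarnessLib

/-!
# Proof of Jones–Smirnov 2000, Cor. 2: boundaries of Hölder domains are conformally removable

P. W. Jones, S. K. Smirnov, *Removability theorems for Sobolev functions and quasiconformal maps*,
Ark. Mat. 38 (2000) 263–279, Corollary 2 (p. 267): "Boundaries of Hölder domains are
quasiconformally removable" — for planar sets quasiconformal and conformal removability coincide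
(p. 264). This file discharges the named fact `JonesSmirnov2000_frontier_of_isHolderDomain` of
`ConformalRemovability.lean`.

The proof formalised in this directory follows the paper's architecture (pp. 265–275) in the
planar conformal case, with Whitney discs in place of Whitney cubes:

* analytic half (§2, "Proposition 1 implies Theorem 1", pp. 269–270):
  `IsConformallyRemovableIn.of_twoPoint'` — Morera + Fubini + the line lemma reduce removability
  of a closed null set `K` to the two-point estimate `‖F x' - F x‖ ≤ ∫_{[x,x']} ‖F'‖` for boundary
  points on a.e. horizontal and a.e. vertical line, and `volume_frontier_eq_zero_of_holderOnWith`
  (`area(∂Ω) = 0`, p. 266, here from the mean porosity of `∂Ω`);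
* geometric half (Prop. 1, pp. 270–272, with the shadows of Thm. 2, pp. 273–275, and the
  summability `Σ q² l² < ∞` of Thm. 3/Cor. 4 for Hölder domains, here via Koskela–Rohde mean
  porosity instead of [JM]/Smith–Stegenga): `ae_twoPoint_horizontal`, and the vertical lines by
  the rotation `w ↦ iw` (`ae_twoPoint_vertical`).
-/

noncomputable section

open Set Metric MeasureTheory Filter Complex

open scoped NNReal ENNReal Topology

namespace Literature.Probability.RandomPlanarGeometry

variable {Ω : Set ℂ}

/-! ### Vertical lines, by rotation -/

/-- `i (t + s i) = (-s) + t i`. [folklore] -/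
theorem I_mul_ofReal_add_ofReal_mul_I (t s : ℝ) :
    I * ((t : ℂ) + (s : ℂ) * I) = ((-s : ℝ) : ℂ) + (t : ℂ) * I := by
  rw [ofReal_neg, mul_add, ← mul_assoc, mul_comm I (s : ℂ), mul_assoc, I_mul_I]
  ring

/-- **Rotating a Hölder domain**: if `φ : 𝔻 → Ω` is a Hölder continuous conformal equivalence,
so is `-i φ : 𝔻 → {w | i w ∈ Ω}`, with the same constants. [folklore] -/
theorem exists_conformalEquiv_preimage_mul_I (φ : ConformalEquiv (ball (0 : ℂ) 1) Ω) {C α : ℝ≥0}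
    (hH : HolderOnWith C α φ (ball (0 : ℂ) 1)) :
    ∃ ψ : ConformalEquiv (ball (0 : ℂ) 1) ((fun w => I * w) ⁻¹' Ω),
      HolderOnWith C α ψ (ball (0 : ℂ) 1) := by
  let ρ : ConformalEquiv Ω ((fun w => I * w) ⁻¹' Ω) :=
    { toFun := fun z => -I * z
      invFun := fun w => I * w
      source := Ω
      target := (fun w => I * w) ⁻¹' Ω
      map_source' := fun z hz => by
        show I * (-I * z) ∈ Ω
        rw [← mul_assoc, mul_neg, I_mul_I, neg_neg, one_mul]
        exact hz
      map_target' := fun w hw => hw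
      left_inv' := fun z _ => by
        show I * (-I * z) = z
        rw [← mul_assoc, mul_neg, I_mul_I, neg_neg, one_mul]
      right_inv' := fun w _ => by
        show -I * (I * w) = w
        rw [← mul_assoc, neg_mul, I_mul_I, neg_neg, one_mul]
      source_eq := rfl
      target_eq := rfl
      differentiableOn := (differentiableOn_id.const_mul (-I))
      differentiableOn_symm := (differentiableOn_id.const_mul I) }
  refine ⟨φ.trans ρ, fun a ha b hb => ?_⟩
  have h1 := hH a ha b hb
  have h2 : edist (φ.trans ρ a) (φ.trans ρ b) = edist (φ a) (φ b) := by
    rw [ConformalEquiv.trans_apply, ConformalEquiv.trans_apply]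
    show edist (-I * φ a) (-I * φ b) = edist (φ a) (φ b)
    rw [edist_eq_enorm_sub, edist_eq_enorm_sub, ← mul_sub, enorm_mul, enorm_neg,
      enorm_eq_nnnorm I, nnnorm_I, ENNReal.coe_one, one_mul]
  rw [h2]
  exact h1

/-- **The two-point estimate on almost every vertical line**, from the horizontal one applied to
`F ∘ (i ·)` on the rotated Hölder domain. [cite: JonesSmirnov2000, Prop. 1 (pp. 270–272)] -/
theorem ae_twoPoint_vertical (φ : ConformalEquiv (ball (0 : ℂ) 1) Ω) {C α : ℝ≥0} (hα : 0 < α)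
    (hH : HolderOnWith C α φ (ball (0 : ℂ) 1)) {U : Set ℂ} (hU : IsOpen U)
    (hKU : frontier Ω ⊆ U) {F : ℂ → ℂ} (hFc : ContinuousOn F U) (hFi : InjOn F U)
    (hFd : DifferentiableOn ℂ F (U \ frontier Ω)) :
    ∀ᵐ x : ℝ, ∀ y y' : ℝ, y ≤ y' → (∀ t ∈ Icc y y', (x : ℂ) + t * I ∈ U) →
      IntervalIntegrable (fun t : ℝ => deriv F (x + t * I)) volume y y' →
      (x : ℂ) + y * I ∈ frontier Ω → (x : ℂ) + y' * I ∈ frontier Ω →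
      ‖F (x + y' * I) - F (x + y * I)‖ ≤ ∫ t in y..y', ‖deriv F (x + t * I)‖ := by
  set ρ : ℂ → ℂ := fun w => I * w with hρ
  set Ω' : Set ℂ := ρ ⁻¹' Ω with hΩ'
  set U' : Set ℂ := ρ ⁻¹' U with hU'
  obtain ⟨ψ, hψ⟩ : ∃ ψ : ConformalEquiv (ball (0 : ℂ) 1) Ω', HolderOnWith C α ψ (ball (0 : ℂ) 1) :=
    exists_conformalEquiv_preimage_mul_I φ hH
  have hρc : Continuous ρ := continuous_const_mul I
  have hfr : frontier Ω' = ρ ⁻¹' frontier Ω :=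
    ((Homeomorph.mulLeft₀ I I_ne_zero).preimage_frontier Ω).symm
  have hU'o : IsOpen U' := hU.preimage hρc
  have hKU' : frontier Ω' ⊆ U' := by
    rw [hfr]
    exact preimage_mono hKU
  set G : ℂ → ℂ := F ∘ ρ with hG
  have hGc : ContinuousOn G U' := hFc.comp hρc.continuousOn fun w hw => hw
  have hGi : InjOn G U' := hFi.comp (fun a _ b _ h => mul_left_cancel₀ I_ne_zero h) fun w hw => hw
  have hGd : DifferentiableOn ℂ G (U' \ frontier Ω') := by
    rw [hfr]
    exact hFd.comp (differentiableOn_id.const_mul I) fun w hw => hw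
  have h := ae_twoPoint_horizontal ψ hα hψ hU'o hKU' hGc hGi hGd
  have h' := (Measure.measurePreserving_neg (volume : Measure ℝ)).quasiMeasurePreserving.ae h
  filter_upwards [h'] with x hx
  intro y y' hyy' hseg hint hyK hy'K
  have hconv : ∀ t : ℝ, ρ ((t : ℂ) + ((-x : ℝ) : ℂ) * I) = (x : ℂ) + (t : ℂ) * I := fun t => by
    simp only [hρ]
    rw [I_mul_ofReal_add_ofReal_mul_I, neg_neg]
  have hderiv : ∀ t : ℝ, deriv G ((t : ℂ) + ((-x : ℝ) : ℂ) * I) = I * deriv F ((x : ℂ) + (t : ℂ) * I) := by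
    intro t
    have := deriv_comp_mul_left I F ((t : ℂ) + ((-x : ℝ) : ℂ) * I)
    rw [smul_eq_mul] at this
    rw [← hconv t]
    exact this
  have hx' := hx y y' hyy' (fun t ht => by
      show ρ ((t : ℂ) + ((-x : ℝ) : ℂ) * I) ∈ U
      rw [hconv t]
      exact hseg t ht)
    (by
      have : (fun t : ℝ => deriv G ((t : ℂ) + ((-x : ℝ) : ℂ) * I)) =
          fun t : ℝ => I * deriv F ((x : ℂ) + (t : ℂ) * I) := funext hderiv
      rw [this]
      exact hint.const_mul I)
    (by rw [hfr]; show ρ _ ∈ frontier Ω; rw [hconv]; exact hyK)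
    (by rw [hfr]; show ρ _ ∈ frontier Ω; rw [hconv]; exact hy'K)
  have e1 : G ((y' : ℂ) + ((-x : ℝ) : ℂ) * I) = F ((x : ℂ) + (y' : ℂ) * I) := by
    show F (ρ _) = _
    rw [hconv]
  have e2 : G ((y : ℂ) + ((-x : ℝ) : ℂ) * I) = F ((x : ℂ) + (y : ℂ) * I) := by
    show F (ρ _) = _
    rw [hconv]
  have e3 : ∫ t in y..y', ‖deriv G ((t : ℂ) + ((-x : ℝ) : ℂ) * I)‖ =
      ∫ t in y..y', ‖deriv F ((x : ℂ) + (t : ℂ) * I)‖ := by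
    refine intervalIntegral.integral_congr fun t _ => ?_
    simp only [hderiv, norm_mul, norm_I, one_mul]
  rw [e1, e2, e3] at hx'
  exact hx'

/-! ### The theorem -/

/-- **Jones–Smirnov 2000, Corollary 2: boundaries of Hölder domains are conformally removable**
(inside every domain containing them). Discharge of the named fact
`JonesSmirnov2000_frontier_of_isHolderDomain`. [cite: JonesSmirnov2000, Cor. 2 (p. 267)] -/
theorem JonesSmirnov2000_frontier_of_isHolderDomain_holds :
    JonesSmirnov2000_frontier_of_isHolderDomain := by
  intro Ω hΩ U hU _ hKU
  obtain ⟨φ, C, α, hα, hH⟩ := hΩ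
  refine IsConformallyRemovableIn.of_twoPoint' hU isClosed_frontier
    (volume_frontier_eq_zero_of_holderOnWith φ hα hH) fun F hFc hFi hFd => ⟨?_, ?_⟩
  · filter_upwards [ae_twoPoint_horizontal φ hα hH hU hKU hFc hFi hFd] with y hy
    intro _ x x' hxx' hseg hint hxK hx'K
    exact hy x x' hxx' hseg hint hxK hx'K
  · filter_upwards [ae_twoPoint_vertical φ hα hH hU hKU hFc hFi hFd] with x hx
    intro _ y y' hyy' hseg hint hyK hy'K
    exact hx y y' hyy' hseg hint hyK hy'K

end Literature.Probability.RandomPlanarGeometry
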